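import Summits.QuantumFields.YangMills.Theorems.BalabanUVNodesN07ChartLinAverageFlatPoint
import Summits.QuantumFields.YangMills.Theorems.BalabanUVNodesN07Eq48AtRecord
import HarnessLib

/-!
# N07 at the record, `N = 2` — TWO OF THE FIVE KNIT TOKENS OF THE K0ᴬ ROAD, (rng) AND (star_mem), IN THE ROAD's OWN SHAPE for the frame-free (47)-carrying chart
# `𝔖♭.chartLin T♭` and the EXPLICIT family `Kc♭_ρ V := {A | Q A = 0, A + 𝔄♭V a Hermitian traceless jet, ‖A + 𝔄♭V‖ < ρ}` (written inline)

Cell `pub-ymgap`, seat `pub-ymgap-dag-n07-w3` (g28, WIDTH SEAT 3 on N07 [B11]); helper file keyed `--supports stmt-QuantumFields-27238 --as helper` (K0ᴬ road);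
count-neutral.  INTENT-24 of the seat.  The road (`K0AxCtabUniq.rootedReceipts_of_tokens_atScale`) displays, for a scheme `S` and a family `Kc`:
(rng) `∀ V ∈ S.dom, ∀ A ∈ Kc V, S.chart V A ∈ bgReg … ∧ Averaging.iter … (S.chart V A) = V`, (star_mem) `∀ V ∈ S.dom, S.sol V ∈ Kc V`, (cov), (star_isMinOn), (sol_of_isMinOn).
For `S := bgSchemeOfRecord F 2 K k Ω U₀ …` with the chart RE-KEYED to `S.chartLin T♭` and the explicit family `Kc♭_ρ`, this file proves (rng) (∃ `ρ`) and (star_mem) BY NAME modulo g27's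
standard displayed rows; (cov) is the Thm 1 hypothesis (it transfers from the (47)-free chart, ✓p832683), (star_isMinOn) ∕ (sol_of_isMinOn) are Prop. 5 ∕ Prop. 7 content — untouched.

## What is here

* ★★ `knitStarMem_flat_two` — (star_mem): `𝒜♭(V) ∈ Kc♭_ρ V` — `Q𝒜♭(V) = 0` ((109), ✓`bgSchemeOfRecord_Q_sol`), the reality of `𝒜♭(V) + 𝔄♭(V)` from the (47)-free chart's Lie token
  (g27 ✓`lieTokAt_bgSchemeOfRecord_two` + ✓`realRows_of_lieTokAt`), and `‖𝒜♭ + 𝔄♭‖ < ε₄ + a𝔄 ≤ ρ`.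
* ★★★ `knitRng_flat_two` — (rng) in the road's shape: `∃ ρ > 0, ∀ scheme parameters, ∀ V ∈ logDiscOfRecord, ∀ A ∈ Kc♭_ρ V, 𝔖♭.chartLin T♭ V A ∈ bgReg F 2 K k ε ∧ Ū^k(𝔖♭.chartLin T♭ V A) = V`
  (✓`exists_radius_knitRng_chartLinFlat_of_realRows_two`), given `U₀ ∈ bgReg F 2 K k ε` guarded below `k` and the Sect. C rows.

## Honest labels

Packaging of landed theorems in the road's token shape; `N = 2`; displayed: g27's standard row list (Prop. 6's regime at `V`, data rows, (20)-smallness, `FrakGSliceTok`), the Sect. C rows,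
`U₀ ∈ bgReg`, radii orderings; nothing of Bałaban's estimates; the road re-press `S.chart ↦ S.chartLin T♭` itself is NOT done here (P3 ∕ porter custody); K0ᴬ ⟨27238⟩ NOT closed; N07 NOT
discharged; R4 is the conditional finite-𝕋⁴ rung `BalabanLadder.UV` only; finite torus at fixed `ε` — nothing continuum ∕ OS ∕ Clay.  **The Yang–Mills mass gap is NOT proved by any of this.**
No `sorry`, no `def`, no `instance ∕ notation`; standard axioms.
[cite: Balaban1985Variational, Thm 1 p.279, (15) p.280, (20) p.281, (47) p.285, (102)–(103) p.293, (109)–(111) p.294, Prop. 6 (115)–(121) p.295, Prop. 7 p.299; Balaban1987RG1, (0.21) p.256, (1.2) p.260]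
-/

set_option autoImplicit false

noncomputable section

open scoped Matrix Matrix.Norms.L2Operator InnerProductSpace Topology

namespace Summit.QuantumFields.YangMills.Theorems.N07ChartLinFlatKnitTokensTwo

open Literature.MathematicalPhysics.QuantumFieldTheory.Balaban1983to89
open Literature.MathematicalPhysics.QuantumFieldTheory.Balaban1983to89.T4Continuum (T4Family)
open Literature.MathematicalPhysics.QuantumFieldTheory.Balaban1983to89.Node00
open B9Eq311TracePairing (starW)
open B11Eq103H1Complex (SiteL2K BondL2K readFun funEquiv QFun)
open B11Eq111FrakG (nabla115)
open B11Eq115Space (NegSize NegSup JetSup)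
open B11Eq174Chart (Regime)
open B11Prop6Scheme (Prop4Hyp)
open B11Eq90V0GroupComposed (T47)
open Summit.QuantumFields.YangMills.Theorems.N07TraceSectorDefs (scalPartW)
open Summit.QuantumFields.YangMills.Theorems.N07Eq48AtRecord (readFun_eq_funEquiv_QFun)
open Summit.QuantumFields.YangMills.Theorems.N07LieTokAtOfRecordTwo (lieTokAt_bgSchemeOfRecord_two)
open Summit.QuantumFields.YangMills.Theorems.N07ChartLinFlatLieTok (realRows_of_lieTokAt)
open Summit.QuantumFields.YangMills.Theorems.N07ChartLinAverageFlatPoint (exists_radius_knitRng_chartLinFlat_of_realRows_two)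

section Two

variable (F : T4Family) {K : ℕ} (k : ℕ) (Ω : ℕ → Set (Site (F.P K) 0)) (U₀ : GaugeField (F.P K) 0 (SU 2))
  [Fact (0 < (F.L : ℝ))] [Fact (0 < (F.P K).eta k)] (levB : PBond (F.P K) k → ℕ) [Fact (0 < c0Rec F K k)] [Fact (∀ c, 0 < wBRec F K k c)] (a : ℝ)
  (hposb : ∀ x, x ≠ 0 → 0 < RCLike.re ⟪x, laplaceAOfRecord F 2 k U₀ (QOfRecord F 2 k U₀) (QflatOfRecord F 2 k) a x⟫_ℂ)
  (hQ : Function.Surjective (QOfRecord F 2 k U₀)) {b C₂ c₄ aC εC : ℝ}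
  (RC : Regime (H1OfRecordAtBgFlat F 2 K k Ω U₀ levB a hposb hQ) 0 (CslOfRecord F 2 K k Ω U₀ levB) b 0 C₂ c₄ 0 aC εC)
  (hCreal : ∀ A : Space115Lit F 2 K k Ω U₀,
    ((JetSup.equiv _ _ (nabla115 ((F.P K).eta k) (unitsOfRecord F 2 U₀))).symm
        (star (JetSup.equiv _ _ (nabla115 ((F.P K).eta k) (unitsOfRecord F 2 U₀)) A)) : Space115Lit F 2 K k Ω U₀) = A →
    ‖A‖ ≤ εC + aC → ((NegSup.equiv _ _).symm (star (NegSup.equiv _ _ (CslOfRecord F 2 K k Ω U₀ levB A))) :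
      NegSize (F.L : ℝ) ((F.P K).eta k) levB 0 (Matrix (Fin 2) (Fin 2) ℂ)) = CslOfRecord F 2 K k Ω U₀ levB A)
  (hCtr : ∀ A : Space115Lit F 2 K k Ω U₀,
    ((JetSup.equiv _ _ (nabla115 ((F.P K).eta k) (unitsOfRecord F 2 U₀))).symm
        (star (JetSup.equiv _ _ (nabla115 ((F.P K).eta k) (unitsOfRecord F 2 U₀)) A)) : Space115Lit F 2 K k Ω U₀) = A →
    (∀ b, (JetSup.equiv _ _ (nabla115 ((F.P K).eta k) (unitsOfRecord F 2 U₀)) A b).trace = 0) →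
    ‖A‖ ≤ εC + aC → ∀ c, (NegSup.equiv _ _ (CslOfRecord F 2 K k Ω U₀ levB A) c).trace = 0)
  (Gp : SiteL2K ℂ (F.P K).d (fun _ => (F.P K).sitesPerDir 0) (c0Rec F K k) (WRec 2) →ₗ[ℂ]
    SiteL2K ℂ (F.P K).d (fun _ => (F.P K).sitesPerDir 0) (c0Rec F K k) (WRec 2))
  (Δ2 : BondL2K ℂ (F.P K).d (fun _ => (F.P K).sitesPerDir 0) (c0Rec F K k) (WRec 2) →ₗ[ℂ]
    BondL2K ℂ (F.P K).d (fun _ => (F.P K).sitesPerDir 0) (c0Rec F K k) (WRec 2))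
  (hposπ : ∀ x, x ≠ 0 → 0 < RCLike.re ⟪x, laplaceAOfRecordAt F 2 k U₀ (hessOpOfRecord128 F 2 k U₀ Gp (QflatOfRecord F 2 k) Δ2)
    (QOfRecord F 2 k U₀) (QflatOfRecord F 2 k) a x⟫_ℂ)

include RC hCreal hCtr in
/-- ★★ **THE KNIT TOKEN (star_mem) FOR THE EXPLICIT FAMILY `Kc♭_ρ` AT `N = 2`**: the fixed point `𝒜♭(V)` lies in
`Kc♭_ρ V = {A | Q A = 0, A + 𝔄♭V Hermitian traceless jet, ‖A + 𝔄♭V‖ < ρ}` whenever `ε₄ + a𝔄 ≤ ρ`, under g27's standard rows at `V` ((109) + the (47)-free chart's Lie token).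
[cite: Balaban1985Variational, (109)–(111) p.294, Prop. 6 (115)–(121) p.295, (15) p.280, (51) p.286] -/
theorem knitStarMem_flat_two (h : SmallBelow (avOfRecord F 2 K) k U₀) (dom : Set (GaugeField (F.P K) k (SU 2))) (B₀ C₄ a₃ j a𝔄 ε₄ : ℝ) {ρ : ℝ} (hfit : ε₄ + a𝔄 ≤ ρ)
    (hGpR : ∀ s, Gp (starW (phiRec 2) s) = starW (phiRec 2) (Gp s)) (hGpS : ∀ s, Gp (scalPartW 2 _ s) = scalPartW 2 _ (Gp s))
    (hΔ2R : ∀ x, Δ2 (starW (phiRec 2) x) = starW (phiRec 2) (Δ2 x)) (hΔ2S : ∀ x, Δ2 (scalPartW 2 _ x) = scalPartW 2 _ (Δ2 x))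
    (hP : Prop4Hyp (CslOfRecord F 2 K k Ω U₀ levB) C₂ c₄) (haC : a₃ ≤ aC)
    (R : Regime (frakGOfRecordAtBg128 F 2 K k Ω U₀ Gp Δ2 a hposπ hQ) (0 : Space115Lit F 2 K k Ω U₀ →L[ℂ] Space115Lit F 2 K k Ω U₀)
      (WOfRecordAt F 2 K k Ω U₀ levB a hposb hQ εC Gp) B₀ 0 C₄ a₃ j a𝔄 ε₄)
    (hJ : ‖JOfRecordAtBg F 2 K k Ω U₀‖ ≤ j) {V : GaugeField (F.P K) k (SU 2)} (h𝔄 : ‖frakAOfRecordAtBg128 F 2 K k Ω U₀ levB Gp Δ2 a hposπ hQ V‖ < a𝔄)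
    (h𝔊 : FrakGSliceTok F 2 K k Ω U₀ Gp Δ2 a hposπ hQ)
    (hV : ∀ c, ‖(V c : Matrix (Fin 2) (Fin 2) ℂ) * star (Averaging.iter (avOfRecord F 2 K) k U₀ c : Matrix (Fin 2) (Fin 2) ℂ) - 1‖ ≤ 1 / 4) :
    (bgSchemeOfRecord F 2 K k Ω U₀ dom levB Gp Δ2 a hposπ hposb hQ εC B₀ C₄ a₃ j a𝔄 ε₄).sol V ∈
      {A : Space115Lit F 2 K k Ω U₀ |
        readFun (phiRec 2) _ (wBRec F K k) (QOfRecord F 2 k U₀) (JetSup.equiv _ _ (nabla115 ((F.P K).eta k) (unitsOfRecord F 2 U₀)) A) = 0 ∧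
        ((JetSup.equiv _ _ (nabla115 ((F.P K).eta k) (unitsOfRecord F 2 U₀))).symm
          (star (JetSup.equiv _ _ (nabla115 ((F.P K).eta k) (unitsOfRecord F 2 U₀)) (A + frakAOfRecordAtBg128 F 2 K k Ω U₀ levB Gp Δ2 a hposπ hQ V))) :
            Space115Lit F 2 K k Ω U₀) = A + frakAOfRecordAtBg128 F 2 K k Ω U₀ levB Gp Δ2 a hposπ hQ V ∧
        (∀ b', (JetSup.equiv _ _ (nabla115 ((F.P K).eta k) (unitsOfRecord F 2 U₀)) (A + frakAOfRecordAtBg128 F 2 K k Ω U₀ levB Gp Δ2 a hposπ hQ V) b').trace = 0) ∧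
        ‖A + frakAOfRecordAtBg128 F 2 K k Ω U₀ levB Gp Δ2 a hposπ hQ V‖ < ρ} := by
  have hL := lieTokAt_bgSchemeOfRecord_two F K k Ω U₀ dom levB a hposπ hposb hQ εC B₀ C₄ a₃ j a𝔄 ε₄ RC hCreal hCtr h hGpR hGpS hΔ2R hΔ2S hP haC R hJ h𝔄 hV
  obtain ⟨hA'herm, hA'tr⟩ := realRows_of_lieTokAt F k Ω U₀ levB a hposb hQ Gp Δ2 hposπ dom B₀ C₄ a₃ j a𝔄 ε₄ (εC := εC) hL
  have hsol := (bgSchemeOfRecord_sol_spec F 2 K k Ω U₀ levB Gp Δ2 a hposπ hposb hQ dom R hJ h𝔄).1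
  refine ⟨?_, hA'herm, hA'tr, ?_⟩
  · rw [readFun_eq_funEquiv_QFun, bgSchemeOfRecord_Q_sol F 2 K k Ω U₀ levB Gp Δ2 a hposπ hposb hQ dom R hJ h𝔄 h𝔊, map_zero]
  · exact lt_of_lt_of_le (lt_of_le_of_lt (norm_add_le _ _) (by linarith)) hfit

include RC hCreal hCtr in
/-- ★★★ **THE KNIT TOKEN (rng) FOR THE EXPLICIT FAMILY `Kc♭_ρ` AT `N = 2`, IN THE ROAD's SHAPE**: one `ρ > 0` (`ρ ≤ a_C`) such that for all scheme parameters, every `V` in the log-disc and every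
`A ∈ Kc♭_ρ V`: `𝔖♭.chartLin T♭ V A ∈ bgReg F 2 K k ε ∧ Averaging.iter (avOfRecord F 2 K) k (𝔖♭.chartLin T♭ V A) = V` — given `U₀ ∈ bgReg F 2 K k ε` guarded below `k` and the Sect. C rows.
[cite: Balaban1987RG1, (0.21) p.256, (1.2) p.260; Balaban1985Variational, (15) p.280, (20) p.281, (47) p.285, (109) p.294] -/
theorem knitRng_flat_two (h : SmallBelow (avOfRecord F 2 K) k U₀) {ε : ℝ} (hU₀reg : U₀ ∈ bgReg F 2 K k ε)
    (hC : Prop4Hyp (CslOfRecord F 2 K k Ω U₀ levB) C₂ c₄) (haC : 0 < aC) :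
    ∃ ρ : ℝ, 0 < ρ ∧ ρ ≤ aC ∧ ∀ (dom : Set (GaugeField (F.P K) k (SU 2))) (B₀ C₄ a₃ j a𝔄 ε₄ : ℝ),
      ∀ V ∈ logDiscOfRecord F 2 K k U₀,
      ∀ A ∈ {A : Space115Lit F 2 K k Ω U₀ |
          readFun (phiRec 2) _ (wBRec F K k) (QOfRecord F 2 k U₀) (JetSup.equiv _ _ (nabla115 ((F.P K).eta k) (unitsOfRecord F 2 U₀)) A) = 0 ∧
          ((JetSup.equiv _ _ (nabla115 ((F.P K).eta k) (unitsOfRecord F 2 U₀))).symm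
            (star (JetSup.equiv _ _ (nabla115 ((F.P K).eta k) (unitsOfRecord F 2 U₀)) (A + frakAOfRecordAtBg128 F 2 K k Ω U₀ levB Gp Δ2 a hposπ hQ V))) :
              Space115Lit F 2 K k Ω U₀) = A + frakAOfRecordAtBg128 F 2 K k Ω U₀ levB Gp Δ2 a hposπ hQ V ∧
          (∀ b', (JetSup.equiv _ _ (nabla115 ((F.P K).eta k) (unitsOfRecord F 2 U₀)) (A + frakAOfRecordAtBg128 F 2 K k Ω U₀ levB Gp Δ2 a hposπ hQ V) b').trace = 0) ∧
          ‖A + frakAOfRecordAtBg128 F 2 K k Ω U₀ levB Gp Δ2 a hposπ hQ V‖ < ρ},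
        (bgSchemeOfRecord F 2 K k Ω U₀ dom levB Gp Δ2 a hposπ hposb hQ εC B₀ C₄ a₃ j a𝔄 ε₄).chartLin
            (fun _ => T47 (H1OfRecordAtBgFlat F 2 K k Ω U₀ levB a hposb hQ) (CslOfRecord F 2 K k Ω U₀ levB) εC) V A ∈ bgReg F 2 K k ε ∧
          Averaging.iter (avOfRecord F 2 K) k ((bgSchemeOfRecord F 2 K k Ω U₀ dom levB Gp Δ2 a hposπ hposb hQ εC B₀ C₄ a₃ j a𝔄 ε₄).chartLin
            (fun _ => T47 (H1OfRecordAtBgFlat F 2 K k Ω U₀ levB a hposb hQ) (CslOfRecord F 2 K k Ω U₀ levB) εC) V A) = V := by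
  obtain ⟨ρ, hρ, hρaC, hfin⟩ := exists_radius_knitRng_chartLinFlat_of_realRows_two F k Ω U₀ levB a hposb hQ RC hCreal hCtr Gp Δ2 hposπ h hU₀reg hC haC
  refine ⟨ρ, hρ, hρaC, fun dom B₀ C₄ a₃ j a𝔄 ε₄ V hV A hA => ?_⟩
  obtain ⟨hQA, hherm, htrA, hn⟩ := hA
  exact hfin dom B₀ C₄ a₃ j a𝔄 ε₄ hV hn hQA hherm htrA

end Two

end Summit.QuantumFields.YangMills.Theorems.N07ChartLinFlatKnitTokensTwo

end
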